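import Summits.ResolutionOfSingularities.ResolutionOfSingularities.Theorems.WeightedInvariantIota3FlagBridge
import Summits.ResolutionOfSingularities.ResolutionOfSingularities.Theorems.WeightedInvariantIota3IsoSucc
import Summits.ResolutionOfSingularities.ResolutionOfSingularities.Theorems.WeightedInvariantIota3SigmaWeightsUnique
import Summits.ResolutionOfSingularities.ResolutionOfSingularities.Theorems.AQSHeightTwoSlopeCompare
import Literature.AlgebraicGeometry.Resolution.RegularLocalRingsQuotient
import HarnessLib

/-!
# (o70-b) PART 1 — CANONICITY OF THE σ-FLAG FILTRATION AT GENERIC SECOND WEIGHT (`r₂ = q`)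
# (door `HypersurfaceCentreConstruction`, stmt-ResolutionOfSingularities-19897; clause h8 ⟸ (σ-pres)₃ ⟸ (o70-a) + (o70-b) + (o70-x);
# SPEC (Δ12) rev 2 `L/res-L1-w43-plan-1/JSigmaCanon_sketch.lean` aceffaa8e08fb006 of res-L1-w43-plan-1; hand res-D-brk-1)

Topic: `Summits/ResolutionOfSingularities/ResolutionOfSingularities/Theorems`. Helper for the door item
`HypersurfaceCentreConstruction` (stmt-ResolutionOfSingularities-19897, route `WeightedInvariant`), line `local-engine`
(L W4.3), def-free.  (J-can) = `JSigmaCanonicalAt f`: two σ-maximising two-flags of `f` (res-type-061's `IsSigmaMaximiser`) with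
primitive weight triples carry the SAME rational contact filtration.  By (o70-w) (`Iota3.sigmaWeights_unique`, p561867) the two
triples agree, and the maximality clause of `IsSigmaMaximiser` does not mention the flag, so (J-can) is a statement about two
two-flags REACHING the same admissible triple `(q; r₁, r₂)`; by `flagContactFiltration_eq_of_mem_of_mem` (p533944) it is MUTUAL
DOMINANCE: `g₁' ∈ F(r₁)`, `g₂' ∈ F(r₂)` and symmetrically.

This file settles the case `r₂ = q` (generic second weight: `F(n) = (g₁)·… + 𝔪^⌈n/q⌉` is a one-member filtration) for a
regular local ring of ANY dimension, from REACHING ALONE: level `r₁ν` splits as `(g₁'^ν) ⊔ REST` with `REST ≤ 𝔪^{ν+1}`, so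
`f = c·g₁'^ν + m` with `c` a unit; in the regular local ring `S̄ = S/(g₁)` one has `f̄ ∈ 𝔪̄^⌈r₁ν/q⌉`, and `ḡ₁' ∈ 𝔪̄ᵗ`, `qt < r₁`
give `REST̄ ≤ 𝔪̄^{νt+1}`, hence `c̄·ḡ₁'^ν ∈ 𝔪̄^{νt+1}` and `ḡ₁' ∈ 𝔪̄^{t+1}` because the order of `S̄` is a valuation
(`Resolution.adicOrder_mul`); climbing `t = 1 … ⌈r₁/q⌉` gives `g₁' ∈ (g₁) + 𝔪^⌈r₁/q⌉ ≤ F(r₁)` (`mem_span_sup_pow_of_reaches`,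
`mem_flagContactFiltration_of_reaches_of_r₂_eq_q`), and symmetrically, whence equal filtrations
(`flagContactFiltration_eq_of_isSigmaMaximiser_of_r₂_eq_q`, primed version at `ν = ord f`).
The complementary case `r₂ > q` (the second member is pinned by the first face of `f`) is PART 2.

[OURS · L1 W4.3 · (o70-b) PART 1]  Replaces the role of NO printed item; NOT a statement of the manuscript
[claim: Hironaka2017, status: under-review]. AI work, weaker than expert review.  Pure commutative algebra; no named facts.

## References

* H. Matsumura, *Commutative Ring Theory* (1987), Thm. 14.2 (`R/(x)` regular), Thm. 17.10. [Matsumura1987]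
* O. Zariski, P. Samuel, *Commutative Algebra* II (1960), Ch. VIII §1 Thm. 1 (order valuation). [ZariskiSamuel1960]
* D. Abramovich, M. Temkin, J. Włodarczyk, Algebra & Number Theory 18 (2024), §5. [AbramovichTemkinWlodarczyk2024]
-/

noncomputable section

set_option linter.dupNamespace false -- mandated namespace `Summit.<Summit>.<Problem>` of this single-conjunct summit

open IsLocalRing Literature.AlgebraicGeometry.Resolution
open Summit.ResolutionOfSingularities.ResolutionOfSingularities.Theorems

namespace Summit.ResolutionOfSingularities.ResolutionOfSingularities.Cruxes.HypersurfaceCentreConstruction.LocalEngine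

namespace Iota3

universe u

/-! ## §0 Arithmetic of the weights `(q; r₁, q)`
(ceilings reused: `Iota3.le_add_mul_cdiv`, `AQSHeightTwo.cdiv_le_of_le_mul`, `AQSHeightTwo.succ_le_cdiv_of_mul_lt`) -/

/-- `t + 1 ≤ ⌈r₁/q⌉ ⇒ q·t < r₁`. [folklore] -/
theorem mul_lt_of_succ_le_cdiv {q r₁ t : ℕ} (hq : 0 < q) (h : t + 1 ≤ (r₁ + q - 1) / q) : q * t < r₁ := by
  have h' := (Nat.le_div_iff_mul_le hq).mp h
  have : (t + 1) * q = q * t + q := by ring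
  omega

/-- Exponent bookkeeping for `REST ≤ 𝔪^{ν+1}`: for `(α, β) ≠ (ν, 0)`, `q < r₁` and `r₁ν − r₁α − qβ ≤ q·e` one has
`ν + 1 ≤ α + β + e`. [folklore] -/
theorem succ_le_of_ne_top_piece {q r₁ ν α β e : ℕ} (hqr : q < r₁) (hne : ¬ (α = ν ∧ β = 0))
    (he : r₁ * ν - r₁ * α - q * β ≤ q * e) : ν + 1 ≤ α + β + e := by
  rcases Nat.lt_or_ge ν α with h | h
  · omega
  · rcases Nat.lt_or_ge α ν with h' | h'
    · -- `α < ν`: write `ν = α + (d + 1)`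
      obtain ⟨d, rfl⟩ : ∃ d, ν = α + (d + 1) := ⟨ν - α - 1, by omega⟩
      rw [Nat.mul_add, Nat.add_sub_cancel_left] at he
      have hr : q * (d + 1) + (d + 1) ≤ r₁ * (d + 1) := by
        calc q * (d + 1) + (d + 1) = (q + 1) * (d + 1) := by ring
          _ ≤ r₁ * (d + 1) := Nat.mul_le_mul_right (d + 1) hqr
      have key : q * (d + 1) + (d + 1) ≤ q * β + q * e := by
        rcases le_or_gt (q * β) (r₁ * (d + 1)) with h2 | h2
        · omega
        · omega
      have hlt : q * (d + 1) < q * (β + e) := by have := Nat.mul_add q β e; omega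
      have := Nat.lt_of_mul_lt_mul_left hlt
      omega
    · -- `α = ν`, so `β ≠ 0`
      have hαν : α = ν := le_antisymm h h'
      omega

/-- Exponent bookkeeping for `π(REST) ≤ 𝔪^{νt+1}`: for `(α, β) ≠ (ν, 0)`, `1 ≤ t`, `q·t < r₁` and `r₁ν − r₁α − qβ ≤ q·e` one has
`νt + 1 ≤ αt + β + e`. [folklore] -/
theorem succ_le_of_ne_top_piece_mul {q r₁ ν α β e t : ℕ} (ht : 1 ≤ t) (hqt : q * t < r₁) (hne : ¬ (α = ν ∧ β = 0))
    (he : r₁ * ν - r₁ * α - q * β ≤ q * e) : ν * t + 1 ≤ α * t + β + e := by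
  rcases Nat.lt_or_ge ν α with h | h
  · have h1 : (ν + 1) * t ≤ α * t := Nat.mul_le_mul_right t h
    have h2 : (ν + 1) * t = ν * t + t := by ring
    omega
  · rcases Nat.lt_or_ge α ν with h' | h'
    · obtain ⟨d, rfl⟩ : ∃ d, ν = α + (d + 1) := ⟨ν - α - 1, by omega⟩
      rw [Nat.mul_add, Nat.add_sub_cancel_left] at he
      have hP : q * (t * (d + 1)) < r₁ * (d + 1) := by
        calc q * (t * (d + 1)) = (q * t) * (d + 1) := by ring
          _ < r₁ * (d + 1) := Nat.mul_lt_mul_of_pos_right hqt (Nat.succ_pos d)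
      have key : q * (t * (d + 1)) < q * β + q * e := by
        rcases le_or_gt (q * β) (r₁ * (d + 1)) with h2 | h2
        · omega
        · omega
      have hlt : q * (t * (d + 1)) < q * (β + e) := by have := Nat.mul_add q β e; omega
      have h3 := Nat.lt_of_mul_lt_mul_left hlt
      have h4 : (α + (d + 1)) * t = α * t + t * (d + 1) := by ring
      omega
    · have hαν : α = ν := le_antisymm h h'
      subst hαν
      omega

/-! ## §1 The one-member shape of the `(q; r₁, q)`-filtration (any local ring) -/

section LocalRing

variable {S : Type u} [CommRing S] [IsLocalRing S]

/-- A piece `(g₁^α g₂^β)·𝔪ᵉ` lies in `𝔪^{α+β+e}` when `g₁, g₂ ∈ 𝔪`. [folklore] -/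
theorem flagPiece_le_pow {g₁ g₂ : S} (hg₁ : g₁ ∈ maximalIdeal S) (hg₂ : g₂ ∈ maximalIdeal S) (α β e : ℕ) :
    Ideal.span {g₁ ^ α * g₂ ^ β} * maximalIdeal S ^ e ≤ maximalIdeal S ^ (α + β + e) := by
  have h : Ideal.span {g₁ ^ α * g₂ ^ β} ≤ maximalIdeal S ^ (α + β) := by
    rw [Ideal.span_singleton_le_iff_mem, pow_add]
    exact Ideal.mul_mem_mul (Ideal.pow_mem_pow hg₁ α) (Ideal.pow_mem_pow hg₂ β)
  calc Ideal.span {g₁ ^ α * g₂ ^ β} * maximalIdeal S ^ e ≤ maximalIdeal S ^ (α + β) * maximalIdeal S ^ e :=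
      Ideal.mul_mono_left h
    _ = maximalIdeal S ^ (α + β + e) := by rw [← pow_add]

/-- **One-member shape at generic second weight.** With `r₂ = q` the second member weighs like any element of `𝔪`, and
`F_{(g₁,g₂;q,r₁,q)}(n) ≤ (g₁) ⊔ 𝔪^⌈n/q⌉`. [folklore] -/
theorem flagContactFiltration_le_span_sup_pow {g₁ g₂ : S} (hg₂ : g₂ ∈ maximalIdeal S) {q : ℕ} (hq : 0 < q) (r₁ n : ℕ) :
    flagContactFiltration g₁ g₂ q r₁ q n ≤ Ideal.span {g₁} ⊔ maximalIdeal S ^ ((n + q - 1) / q) := by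
  rw [flagContactFiltration_def]
  refine iSup_le fun α => iSup_le fun β => ?_
  rcases Nat.eq_zero_or_pos α with hα | hα
  · subst hα
    refine le_sup_of_le_right ?_
    set e := (n - r₁ * 0 - q * β + q - 1) / q with he
    have hβe : (n + q - 1) / q ≤ β + e := by
      refine AQSHeightTwo.cdiv_le_of_le_mul hq ?_
      have h1 : n - q * β ≤ q * e := by
        have := le_add_mul_cdiv hq (n - q * β) 0
        simpa [he] using this
      rw [Nat.mul_add]
      omega
    calc Ideal.span {g₁ ^ 0 * g₂ ^ β} * maximalIdeal S ^ e ≤ maximalIdeal S ^ (β + e) := by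
          rw [pow_zero, one_mul]
          calc Ideal.span {g₂ ^ β} * maximalIdeal S ^ e ≤ maximalIdeal S ^ β * maximalIdeal S ^ e :=
              Ideal.mul_mono_left ((Ideal.span_singleton_le_iff_mem _).mpr (Ideal.pow_mem_pow hg₂ β))
            _ = maximalIdeal S ^ (β + e) := by rw [← pow_add]
      _ ≤ maximalIdeal S ^ ((n + q - 1) / q) := Ideal.pow_le_pow_right hβe
  · refine le_sup_of_le_left ((Ideal.mul_le_right).trans ?_)
    rw [Ideal.span_singleton_le_span_singleton]
    exact (dvd_pow_self g₁ hα.ne').mul_right _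

/-- Level `r₁ν` of the `(q; r₁, q)`-filtration splits off its top piece `(g₁^ν)`:
`F(r₁ν) ≤ (g₁^ν) ⊔ REST`, `REST = ⨆_{(α,β) ≠ (ν,0)} (g₁^α g₂^β)·𝔪^⌈(r₁ν − r₁α − qβ)/q⌉`. [folklore] -/
theorem flagContactFiltration_le_span_pow_sup_rest (g₁ g₂ : S) (q r₁ ν : ℕ) :
    flagContactFiltration g₁ g₂ q r₁ q (r₁ * ν) ≤ Ideal.span {g₁ ^ ν} ⊔
      ⨆ α : ℕ, ⨆ β : ℕ, ⨆ (_ : ¬ (α = ν ∧ β = 0)),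
        Ideal.span {g₁ ^ α * g₂ ^ β} * maximalIdeal S ^ ((r₁ * ν - r₁ * α - q * β + q - 1) / q) := by
  rw [flagContactFiltration_def]
  refine iSup_le fun α => iSup_le fun β => ?_
  by_cases h : α = ν ∧ β = 0
  · obtain ⟨rfl, rfl⟩ := h
    refine le_sup_of_le_left ((Ideal.mul_le_right).trans ?_)
    rw [pow_zero, mul_one]
  · exact le_sup_of_le_right (le_iSup_of_le α (le_iSup_of_le β (le_iSup_of_le h le_rfl)))

/-- `REST ≤ 𝔪^{ν+1}` when `q < r₁` (every piece other than `(g₁^ν)` has `𝔪`-adic order `> ν`). [folklore] -/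
theorem rest_le_pow_succ {g₁ g₂ : S} (hg₁ : g₁ ∈ maximalIdeal S) (hg₂ : g₂ ∈ maximalIdeal S) {q r₁ : ℕ} (hq : 0 < q)
    (hqr : q < r₁) (ν : ℕ) :
    (⨆ α : ℕ, ⨆ β : ℕ, ⨆ (_ : ¬ (α = ν ∧ β = 0)),
        Ideal.span {g₁ ^ α * g₂ ^ β} * maximalIdeal S ^ ((r₁ * ν - r₁ * α - q * β + q - 1) / q)) ≤
      maximalIdeal S ^ (ν + 1) := by
  refine iSup_le fun α => iSup_le fun β => iSup_le fun hne => ?_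
  set e := (r₁ * ν - r₁ * α - q * β + q - 1) / q with he
  have hE : ν + 1 ≤ α + β + e :=
    succ_le_of_ne_top_piece hqr hne (by simpa [he] using le_add_mul_cdiv hq (r₁ * ν - r₁ * α - q * β) 0)
  exact (flagPiece_le_pow hg₁ hg₂ α β e).trans (Ideal.pow_le_pow_right hE)

/-- `π(REST) ≤ 𝔪_T^{νt+1}` for a ring map `π` into a local ring `T` with `π(𝔪_S) ≤ 𝔪_T`, `π g₁ ∈ 𝔪_Tᵗ` (`1 ≤ t`, `qt < r₁`) and
`π g₂ ∈ 𝔪_T`. [folklore] -/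
theorem map_rest_le_pow {T : Type u} [CommRing T] [IsLocalRing T] (π : S →+* T)
    (hπ : (maximalIdeal S).map π ≤ maximalIdeal T) {g₁ g₂ : S} {q r₁ ν t : ℕ} (hq : 0 < q) (ht : 1 ≤ t) (hqt : q * t < r₁)
    (h₁ : π g₁ ∈ maximalIdeal T ^ t) (h₂ : π g₂ ∈ maximalIdeal T) :
    (⨆ α : ℕ, ⨆ β : ℕ, ⨆ (_ : ¬ (α = ν ∧ β = 0)),
        Ideal.span {g₁ ^ α * g₂ ^ β} * maximalIdeal S ^ ((r₁ * ν - r₁ * α - q * β + q - 1) / q)).map π ≤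
      maximalIdeal T ^ (ν * t + 1) := by
  rw [Ideal.map_iSup]; refine iSup_le fun α => ?_
  rw [Ideal.map_iSup]; refine iSup_le fun β => ?_
  rw [Ideal.map_iSup]; refine iSup_le fun hne => ?_
  set e := (r₁ * ν - r₁ * α - q * β + q - 1) / q with he
  have hE : ν * t + 1 ≤ α * t + β + e :=
    succ_le_of_ne_top_piece_mul ht hqt hne (by simpa [he] using le_add_mul_cdiv hq (r₁ * ν - r₁ * α - q * β) 0)
  rw [Ideal.map_mul, Ideal.map_span, Set.image_singleton, map_mul, map_pow, map_pow, Ideal.map_pow]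
  have hA : Ideal.span {π g₁ ^ α * π g₂ ^ β} ≤ maximalIdeal T ^ (α * t + β) := by
    rw [Ideal.span_singleton_le_iff_mem, pow_add]
    refine Ideal.mul_mem_mul ?_ (Ideal.pow_mem_pow h₂ β)
    rw [mul_comm, pow_mul]
    exact Ideal.pow_mem_pow h₁ α
  calc Ideal.span {π g₁ ^ α * π g₂ ^ β} * (maximalIdeal S).map π ^ e
      ≤ maximalIdeal T ^ (α * t + β) * maximalIdeal T ^ e := Ideal.mul_mono hA (Ideal.pow_right_mono hπ e)
    _ = maximalIdeal T ^ (α * t + β + e) := by rw [← pow_add]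
    _ ≤ maximalIdeal T ^ (ν * t + 1) := Ideal.pow_le_pow_right hE

end LocalRing

/-! ## §2 The induction in `S/(g₁)` (regular local rings) -/

section Regular

variable {S : Type u} [CommRing S] [IsRegularLocalRing S]

/-- **The order step.** In a regular local ring `T` receiving `π : S → T` (`π 𝔪_S ≤ 𝔪_T`): if `f = c·g₁'^ν + m` with `c` a unit and
`m ∈ REST(g₁', g₂')`, `π f ∈ 𝔪_T^{νt+1}`, `π g₁' ∈ 𝔪_Tᵗ` (`1 ≤ t`, `qt < r₁`), `π g₂' ∈ 𝔪_T`, then `π g₁' ∈ 𝔪_T^{t+1}` — because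
`ord_T(π c · π g₁'^ν) = ν · ord_T(π g₁') ≥ νt + 1` (the order of a regular local ring is a valuation).
[cite: ZariskiSamuel1960, Ch. VIII §1 Thm. 1] -/
theorem map_mem_pow_succ_of_decomposition {T : Type u} [CommRing T] [IsRegularLocalRing T] (π : S →+* T)
    (hπ : (maximalIdeal S).map π ≤ maximalIdeal T) {f c m g₁' g₂' : S} {q r₁ ν t : ℕ} (hq : 0 < q) (ht : 1 ≤ t)
    (hqt : q * t < r₁) (hsum : c * g₁' ^ ν + m = f) (hc : IsUnit c)
    (hm : m ∈ ⨆ α : ℕ, ⨆ β : ℕ, ⨆ (_ : ¬ (α = ν ∧ β = 0)),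
        Ideal.span {g₁' ^ α * g₂' ^ β} * maximalIdeal S ^ ((r₁ * ν - r₁ * α - q * β + q - 1) / q))
    (hfT : π f ∈ maximalIdeal T ^ (ν * t + 1)) (h₁ : π g₁' ∈ maximalIdeal T ^ t) (h₂ : π g₂' ∈ maximalIdeal T) :
    π g₁' ∈ maximalIdeal T ^ (t + 1) := by
  have hmT : π m ∈ maximalIdeal T ^ (ν * t + 1) := map_rest_le_pow π hπ hq ht hqt h₁ h₂ (Ideal.mem_map_of_mem π hm)
  have hcg : π c * π g₁' ^ ν ∈ maximalIdeal T ^ (ν * t + 1) := by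
    have : π c * π g₁' ^ ν = π f - π m := by rw [← hsum, map_add, map_mul, map_pow]; ring
    rw [this]
    exact Ideal.sub_mem _ hfT hmT
  -- orders: `νt + 1 ≤ ord(π c · π g₁'^ν) = ν · ord(π g₁')`
  have hord : ((ν * t + 1 : ℕ) : ℕ∞) ≤ (ν : ℕ∞) * adicOrder (π g₁') := by
    have h := (le_adicOrder_iff _ _).mpr hcg
    rwa [adicOrder_mul, adicOrder_pow, adicOrder_of_isUnit (hc.map π), zero_add] at h
  rw [← le_adicOrder_iff]
  by_cases htop : adicOrder (π g₁') = ⊤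
  · rw [htop]; exact le_top
  obtain ⟨s, hs⟩ := ENat.ne_top_iff_exists.mp htop
  rw [← hs] at hord ⊢
  have hst : ν * t + 1 ≤ ν * s := by exact_mod_cast hord
  have hts : t < s := by
    by_contra hcon
    have := Nat.mul_le_mul_left ν (not_lt.mp hcon)
    omega
  exact_mod_cast hts

/-- **The induction.** `f ∉ 𝔪^{ν+1}` in level `r₁ν` of the `(q; r₁, q)`-filtrations of BOTH `(g₁, g₂)` (`g₁ ∈ 𝔪 ∖ 𝔪²`, `g₂ ∈ 𝔪`) and
`(g₁', g₂')` (`g₁', g₂' ∈ 𝔪`), `0 < q < r₁`, `0 < ν` ⇒ `g₁' ∈ (g₁) + 𝔪^⌈r₁/q⌉`: in the regular local ring `S/(g₁)` the class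
of `g₁'` climbs from `𝔪̄ᵗ` to `𝔪̄^{t+1}` as long as `qt < r₁` (`map_mem_pow_succ_of_decomposition`).
[cite: Matsumura1987, Thm. 14.2] -/
theorem mem_span_sup_pow_of_reaches {f g₁ g₂ g₁' g₂' : S} {q r₁ ν : ℕ} (hq : 0 < q) (hqr : q < r₁) (hν : 0 < ν)
    (hf : f ∉ maximalIdeal S ^ (ν + 1)) (hg₁ : g₁ ∈ maximalIdeal S) (hg₁2 : g₁ ∉ maximalIdeal S ^ 2)
    (hg₂ : g₂ ∈ maximalIdeal S) (hg₁' : g₁' ∈ maximalIdeal S) (hg₂' : g₂' ∈ maximalIdeal S)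
    (hF : f ∈ flagContactFiltration g₁ g₂ q r₁ q (r₁ * ν)) (hF' : f ∈ flagContactFiltration g₁' g₂' q r₁ q (r₁ * ν)) :
    g₁' ∈ Ideal.span {g₁} ⊔ maximalIdeal S ^ ((r₁ + q - 1) / q) := by
  -- the decomposition `f = c · g₁'^ν + m`
  obtain ⟨a, ha, m, hm, hsum⟩ := Submodule.mem_sup.mp (flagContactFiltration_le_span_pow_sup_rest g₁' g₂' q r₁ ν hF')
  obtain ⟨c, rfl⟩ := Ideal.mem_span_singleton'.mp ha
  have hc : IsUnit c := by
    by_contra hcu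
    have hcm : c ∈ maximalIdeal S := (IsLocalRing.mem_maximalIdeal c).mpr hcu
    refine hf ?_
    rw [← hsum]
    refine Ideal.add_mem _ ?_ (rest_le_pow_succ hg₁' hg₂' hq hqr ν hm)
    rw [pow_succ']
    exact Ideal.mul_mem_mul hcm (Ideal.pow_mem_pow hg₁' ν)
  -- the regular local ring `S/(g₁)`
  haveI hreg : IsRegularLocalRing (S ⧸ Ideal.span {g₁}) := (IsRegularLocalRing.quotient_span_singleton hg₁ hg₁2).1
  set π : S →+* S ⧸ Ideal.span {g₁} := Ideal.Quotient.mk (Ideal.span {g₁}) with hπdef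
  have hπ𝔪 : (maximalIdeal S).map π = maximalIdeal (S ⧸ Ideal.span {g₁}) :=
    (maximalIdeal_quotient_eq_map (Ideal.span {g₁})).symm
  have hπle : (maximalIdeal S).map π ≤ maximalIdeal (S ⧸ Ideal.span {g₁}) := hπ𝔪.le
  -- `π f ∈ 𝔪̄^⌈r₁ν/q⌉`
  have hfbar : π f ∈ maximalIdeal (S ⧸ Ideal.span {g₁}) ^ ((r₁ * ν + q - 1) / q) := by
    obtain ⟨s, hs, m₀, hm₀, hsm⟩ := Submodule.mem_sup.mp (flagContactFiltration_le_span_sup_pow hg₂ hq r₁ (r₁ * ν) hF)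
    have hs0 : π s = 0 := Ideal.Quotient.eq_zero_iff_mem.mpr hs
    rw [← hsm, map_add, hs0, zero_add, ← hπ𝔪, ← Ideal.map_pow]
    exact Ideal.mem_map_of_mem π hm₀
  have h₂ : π g₂' ∈ maximalIdeal (S ⧸ Ideal.span {g₁}) := hπle (Ideal.mem_map_of_mem π hg₂')
  -- the climb
  have key : ∀ t, 1 ≤ t → t ≤ (r₁ + q - 1) / q → π g₁' ∈ maximalIdeal (S ⧸ Ideal.span {g₁}) ^ t := by
    intro t ht
    induction t, ht using Nat.le_induction with
    | base =>
      intro _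
      rw [pow_one]
      exact hπle (Ideal.mem_map_of_mem π hg₁')
    | succ t ht ih =>
      intro htc
      have hqt : q * t < r₁ := mul_lt_of_succ_le_cdiv hq htc
      have h₁ := ih (by omega)
      have hlev : ν * t + 1 ≤ (r₁ * ν + q - 1) / q := by
        refine AQSHeightTwo.succ_le_cdiv_of_mul_lt hq ?_
        calc q * (ν * t) = (q * t) * ν := by ring
          _ < r₁ * ν := Nat.mul_lt_mul_of_pos_right hqt hν
      exact map_mem_pow_succ_of_decomposition π hπle hq ht hqt hsum hc hm ((Ideal.pow_le_pow_right hlev) hfbar) h₁ h₂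
  have hc1 : 1 ≤ (r₁ + q - 1) / q := by
    rw [Nat.le_div_iff_mul_le hq]
    omega
  have hbar := key _ hc1 le_rfl
  -- pull back to `S`
  rw [← hπ𝔪, ← Ideal.map_pow] at hbar
  obtain ⟨m₁, hm₁, hπm₁⟩ := (Ideal.mem_map_iff_of_surjective π Ideal.Quotient.mk_surjective).mp hbar
  have hdiff : g₁' - m₁ ∈ Ideal.span {g₁} := by
    rw [hπdef] at hπm₁
    exact Ideal.Quotient.eq.mp hπm₁.symm
  have : g₁' = (g₁' - m₁) + m₁ := by ring
  rw [this]
  exact Submodule.add_mem_sup hdiff hm₁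

/-- **(o70-b) PART 1, dominance at generic second weight — from reaching alone.** In a regular local ring (any dimension): if
`f ∉ 𝔪^{ν+1}` (`0 < ν`) lies in level `r₁ν` of the `(q; r₁, q)`-filtrations of a two-flag `(g₁, g₂)` and of a pair
`g₁', g₂' ∈ 𝔪` (`0 < q ≤ r₁`), then `g₁' ∈ F_{(g₁,g₂)}(r₁)` and `g₂' ∈ F_{(g₁,g₂)}(q)`.  No maximality is used.
[OURS · L1 W4.3 · (o70-b)] -/
theorem mem_flagContactFiltration_of_reaches_of_r₂_eq_q {f g₁ g₂ g₁' g₂' : S} {q r₁ ν : ℕ} (hq : 0 < q) (hq₁ : q ≤ r₁)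
    (hν : 0 < ν) (hf : f ∉ maximalIdeal S ^ (ν + 1)) (hΦ : IsTwoFlag g₁ g₂) (hg₁' : g₁' ∈ maximalIdeal S)
    (hg₂' : g₂' ∈ maximalIdeal S) (hF : f ∈ flagContactFiltration g₁ g₂ q r₁ q (r₁ * ν))
    (hF' : f ∈ flagContactFiltration g₁' g₂' q r₁ q (r₁ * ν)) :
    g₁' ∈ flagContactFiltration g₁ g₂ q r₁ q r₁ ∧ g₂' ∈ flagContactFiltration g₁ g₂ q r₁ q q := by
  refine ⟨?_, maximalIdeal_le_flagContactFiltration g₁ g₂ r₁ q hq hg₂'⟩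
  rcases Nat.lt_or_ge q r₁ with hqr | hqr
  · obtain ⟨s, hs, m, hm, hsm⟩ := Submodule.mem_sup.mp
      (mem_span_sup_pow_of_reaches hq hqr hν hf hΦ.1 hΦ.left_not_mem_sq hΦ.2.1 hg₁' hg₂' hF hF')
    obtain ⟨a, rfl⟩ := Ideal.mem_span_singleton'.mp hs
    rw [← hsm]
    refine Ideal.add_mem _ (Ideal.mul_mem_left _ a (self_mem_flagContactFiltration g₁ g₂ r₁ q hq).1) ?_
    exact mem_flagContactFiltration_of_mem_pow hq hm (by simpa using le_add_mul_cdiv hq r₁ 0)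
  · obtain rfl : r₁ = q := le_antisymm hqr hq₁
    exact maximalIdeal_le_flagContactFiltration g₁ g₂ r₁ r₁ hq hg₁'

end Regular

/-! ## §3 (J-can) at generic second weight -/

section Canonical

variable {S : Type} [CommRing S] [IsRegularLocalRing S]

/-- **(o70-b) PART 1: (J-can) for σ-maximisers with `r₂ = q`.** Two σ-maximising two-flags of `f` (`f ∉ 𝔪^{ν+1}`, `0 < ν`) with
the same triple `(q; r₁, r₂)`, `r₂ = q`, have the SAME filtration, level by level (mutual dominance by
`mem_flagContactFiltration_of_reaches_of_r₂_eq_q`, then `flagContactFiltration_eq_of_mem_of_mem`). [OURS · L1 W4.3 · (o70-b)] -/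
theorem flagContactFiltration_eq_of_isSigmaMaximiser_of_r₂_eq_q {f : S} {ν : ℕ} {g₁ g₂ g₁' g₂' : S} {q r₁ r₂ : ℕ}
    (hν : 0 < ν) (hf : f ∉ maximalIdeal S ^ (ν + 1)) (h : IsSigmaMaximiser f ν g₁ g₂ q r₁ r₂)
    (h' : IsSigmaMaximiser f ν g₁' g₂' q r₁ r₂) (hr₂ : r₂ = q) (n : ℕ) :
    flagContactFiltration g₁' g₂' q r₁ r₂ n = flagContactFiltration g₁ g₂ q r₁ r₂ n := by
  subst hr₂
  have hq : 0 < r₂ := h.1.1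
  have hq₁ : r₂ ≤ r₁ := h.1.2.2
  obtain ⟨h₁, h₂⟩ := mem_flagContactFiltration_of_reaches_of_r₂_eq_q hq hq₁ hν hf h.2.1 h'.2.1.1 h'.2.1.2.1 h.2.2.1 h'.2.2.1
  obtain ⟨h₁', h₂'⟩ := mem_flagContactFiltration_of_reaches_of_r₂_eq_q hq hq₁ hν hf h'.2.1 h.2.1.1 h.2.1.2.1 h'.2.2.1 h.2.2.1
  exact flagContactFiltration_eq_of_mem_of_mem hq h₁ h₂ h₁' h₂' n

/-- The same with PRIMITIVE triples a priori different: by (o70-w) `Iota3.sigmaWeights_unique` they agree, so for `r₂ = q` the two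
σ-maximisers carry the same filtration. [OURS · L1 W4.3 · (o70-b)] -/
theorem flagContactFiltration_eq_of_isSigmaMaximiser_of_isPrimitiveTriple_of_r₂_eq_q {f : S} {ν : ℕ} {g₁ g₂ g₁' g₂' : S}
    {q r₁ r₂ q' r₁' r₂' : ℕ} (hν : 0 < ν) (hf : f ∉ maximalIdeal S ^ (ν + 1))
    (h : IsSigmaMaximiser f ν g₁ g₂ q r₁ r₂) (hp : IsPrimitiveTriple q r₁ r₂)
    (h' : IsSigmaMaximiser f ν g₁' g₂' q' r₁' r₂') (hp' : IsPrimitiveTriple q' r₁' r₂') (hr₂ : r₂ = q) (n : ℕ) :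
    flagContactFiltration g₁' g₂' q' r₁' r₂' n = flagContactFiltration g₁ g₂ q r₁ r₂ n := by
  obtain ⟨rfl, rfl, rfl⟩ := sigmaWeights_unique h hp h' hp'
  exact flagContactFiltration_eq_of_isSigmaMaximiser_of_r₂_eq_q hν hf h h' hr₂ n

/-- **(o70-b) PART 1 at `ν = ord f`** (the shape of `JSigmaCanonicalAt f`, SPEC (Δ12) l.76, restricted to `r₂ = q`): for `f ≠ 0` in
`𝔪`, two σ-maximisers at `ν = ord f` with primitive triples, one of which has `r₂ = q`, carry the same filtration.
[OURS · L1 W4.3 · (o70-b)] -/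
theorem flagContactFiltration_eq_of_isSigmaMaximiser_of_r₂_eq_q' {f : S} (hf0 : f ≠ 0) (hfm : f ∈ maximalIdeal S)
    {g₁ g₂ g₁' g₂' : S} {q r₁ r₂ q' r₁' r₂' : ℕ}
    (h : IsSigmaMaximiser f (adicOrder f).toNat g₁ g₂ q r₁ r₂) (hp : IsPrimitiveTriple q r₁ r₂)
    (h' : IsSigmaMaximiser f (adicOrder f).toNat g₁' g₂' q' r₁' r₂') (hp' : IsPrimitiveTriple q' r₁' r₂') (hr₂ : r₂ = q)
    (n : ℕ) : flagContactFiltration g₁' g₂' q' r₁' r₂' n = flagContactFiltration g₁ g₂ q r₁ r₂ n := by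
  obtain ⟨ν, hν⟩ := ENat.ne_top_iff_exists.mp (adicOrder_ne_top hf0)
  have hto : (adicOrder f).toNat = ν := by rw [← hν]; rfl
  rw [hto] at h h'
  have hν1 : 0 < ν := by
    have h1 : ((1 : ℕ) : ℕ∞) ≤ adicOrder f := (le_adicOrder_iff f 1).mpr (by rwa [pow_one])
    rw [← hν] at h1
    exact_mod_cast h1
  have hfν : f ∉ maximalIdeal S ^ (ν + 1) := (adicOrder_le_iff f ν).mp (by rw [← hν])
  exact flagContactFiltration_eq_of_isSigmaMaximiser_of_isPrimitiveTriple_of_r₂_eq_q hν1 hfν h hp h' hp' hr₂ n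

end Canonical

end Iota3

end Summit.ResolutionOfSingularities.ResolutionOfSingularities.Cruxes.HypersurfaceCentreConstruction.LocalEngine

end
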